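import Summits.CriticalPhenomena.SAWScalingLimit.Theorems.SAWTowerCountSpectralPin
import Summits.CriticalPhenomena.SAWScalingLimit.Theorems.SAWTowerCountPoissonKernelExpansion

/-!
# Line `birth` — registered skeleton for the crux `CorridorMassFiveEighths` (stmt-CriticalPhenomena-7252)

Crux (FIXED; rank 0, kind crux since the 2026-08-16 auto-crux backfill, of
`route-CriticalPhenomena-SAWTowerCount`; a hypothesis of that route's deciding theorem `closes`):
corridor mass covariance of the critical `ℤ²` self-avoiding walk with exponent EXACTLY `5/8` — there is a
lattice normalisation `A : ℕ → ℝ₊`, regularly varying of index `5/4`, with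
`A(n)·Z_n(⌊mn⌋; ⌊yn⌋, ⌊y′n⌋) → H_m(y,y′)^(5/8)` locally uniformly on `(m,y,y′) ∈ (0,∞)×(0,1)²`
(`Z_n(ℓ;i,j)` = the `x_c`-weighted count of SAWs of `ℤ²` from `(0,i)` to `(ℓ,j)` inside `[0,ℓ]×[1,n]`,
`H_m` = the Poisson excursion kernel between the two ends of `(0,m)×(0,1)`, both inlined in the route file).

## The cut — the route's own layer 1 ("X₀ is DERIVED from (T) LevelTwoSolitude and (C) CorridorCovariance"),
## with the repair that the prover of `SpectralPin` (stmt-CriticalPhenomena-7259) found necessary and PROVED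

The route filed the glue `SpectralPin : KacRankPin → PoissonKernelExpansion → LevelTwoSolitude →
CorridorCovariance → CorridorMassFiveEighths` (stmt-7259).  Its prover showed (item evidence
`SpectralPin-misstated.md`, 2026-08-16) that the glue is NOT derivable as typed — `LevelTwoSolitude` bounds
everything relative to its own top term and never separates `λ₁, λ₂, …` from `λ₀` uniformly in `n`, so an
over-normalised cancelling partner `e₁ = −1, λ₁ = λ₀e^{−ε_n/n}, ε_n → 0` satisfies its body for abstract `Z`
at every exponent `b` — and LANDED the repaired glue in the tree:
`Theorems.SpectralPin.corridorMassFiveEighths_of_levelOneGap (θ) (0 < θ) (θ ≤ 5/4) :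
PoissonKernelExpansion → (LevelTwoSolitude with the extra clause k ≠ 0 → λ_k ≤ λ₀e^{−θπ/n}) →
CorridorCovariance → CorridorMassFiveEighths` (file `Theorems/SAWTowerCountSpectralPin.lean` + five helper
files, ≈ 2100 lines: a priori bounds, ultrafilter limits, termwise identification of two exponential
expansions of `m ↦ H_m(y,y′)^b`, the level-2 kernel is a limit of rank-one kernels, its `{1/2,1/3}²` minor is
`b²(8b−5)`, hence `b = 5/8`), while `PoissonKernelExpansion` is proved (`Theorems.poissonKernelExpansion_proof`).
So the crux reduces, KERNEL-CHECKED, to lattice statements about the width-`n` strip of `ℤ²` at `x_c`.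
This skeleton names them so that the two existing staffed cruxes stay verbatim and the repair is isolated as
ONE new, intrinsic statement plus a provable transfer:

* T  `stub_levelTwoSolitude : LevelTwoSolitude` — route item stmt-CriticalPhenomena-7253 BY NAME (crux, rank 2,
  open-problem): the card's count, typed on the end-to-end strip partition functions — finitely many REAL,
  positive, distinct rates above the line `λ₀e^{−9π/4n}`, rank-one sign-free couplings, bounds relative to
  the Perron term, and EXACTLY ONE rate in the level-2 window `(λ₀e^{−9π/4n}, λ₀e^{−5π/4n})`.
* U  `stub_uniformLevelOneGap` — NEW, the repair made intrinsic (no representation data): a UNIFORM LEVEL-ONE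
  GAP of the strip transfer spectrum coupled to bulk end insertions — `∃ θ > 0` such that for every bulk
  margin `η`, all large widths `n` and all bulk rows `i, j ∈ [ηn,(1−η)n]`, `Z_n(ℓ;i,j) = c·μ^ℓ + O((μ·e^{−θπ/n})^ℓ)`
  as `ℓ → ∞` for some `c, μ > 0` (necessarily `μ = λ₀(n)`, `c` = the Perron amplitude).  Equivalently: the
  largest subdominant rate genuinely coupled to `(i,j)` is `≤ λ₀e^{−θπ/n}` — the first scaled gap does not
  close.  Conformal prediction: scaled gap → 1 (the level-1 descendant; card data 0.72–0.87 at widths ≤ 9,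
  increasing), so any `θ < 1` should do; `θ` is deliberately existential (typing checklist 4c(iv)).
* G  `stub_gapUpgrade : LevelTwoSolitude → U → GappedLevelTwoSolitude` — PROVABLE-NOW transfer (size M):
  uniqueness of exponential asymptotics.  Fix `η`, a large `n ≥ 1` and bulk `(i,j)`; T's representation has
  true top term `u₀(i)u₀(j)λ₀^ℓ` (the other named rates are `< λ₀`, the tail is `O((λ₀e^{−9π/4n})^ℓ)`), and so
  does U's (`c μ^ℓ`), hence `μ = λ₀`, `c = u₀(i)u₀(j)`; then every named rate `λ_k > λ₀e^{−θπ/n}`, `k ≠ 0`,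
  with `u_k(i)u_k(j) ≠ 0` would dominate `Z − u₀u₀λ₀^ℓ`, contradicting U — so such `k` have `u_k ≡ 0` on bulk
  rows (take `i = j`) and can be DROPPED from the representation (re-index; with `θ' = min θ (5/4)` the unique
  window rate is kept, distinctness / `e 0 = 1` / relative bounds / tail are inherited).  The conclusion
  `GappedLevelTwoSolitude` is VERBATIM the hypothesis `hLTS` of the landed glue with `∃ θ, 0 < θ ∧ θ ≤ 5/4 ∧ …`
  in front (the clause is monotone in `θ`, so the cap costs nothing).
* C  `stub_corridorCovariance : CorridorCovariance` — route item stmt-CriticalPhenomena-7254 BY NAME (crux,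
  rank 3, open-problem): LSW / Dyhr–Gilbert–Kennedy–Lawler–Passon mass covariance in corridors with SOME
  exponent `b > 0` (the count, not this stub, pins `b`).

`CorridorMassFiveEighths_of` (kernel-checked, no `sorry` of its own): `G T U` gives `θ ∈ (0,5/4]` and the gapped
count; the landed glue at that `θ`, fed `poissonKernelExpansion_proof` and `C`, is the crux BY NAME.
Load-bearing / hardest stubs: C (it IS conformal covariance of the SAW mass in corridors, open since LSW 2004)
and T (no rigorous handle on the non-symmetric, non-integrable `ℤ²` SAW transfer spectrum beyond
Perron–Frobenius); U is open but of the same kind as T (a spectral statement one level up); G is routine.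
Nothing is lost by the cut: C is implied by the crux (`b = 5/8`), and T ∧ U ∧ G ⇔ the gapped count that the
route's thesis bets on.

Disproof used: none relevant — `ledger crux ls stmt-CriticalPhenomena-7252` had no workfiles (no `Disproof.lean`,
no `_false_without_` theorem) on 2026-08-17.  Negatives index (11 entries) checked: none concerns strip
partition functions / transfer spectra; the refuted all-δ tightness stmt-0772 is not touched (no stub speaks
of SAW laws).  Landed inputs USED, not re-stubbed: `Theorems.SpectralPin.corridorMassFiveEighths_of_levelOneGap`,
`Theorems.poissonKernelExpansion_proof` (and, inside the former, `Theorems.SpectralPin.pin_abstract`).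

Conventions: every inlined `let Z := …` below is the route file's text character for character and is
elaborated under `open scoped Classical` (as the route file and the landed glue are), so the `DecidablePred`
instances — hence the terms — coincide; stubs are stated in TREE VOCABULARY ONLY (route decls by name, or the
formula written out), so each lands verbatim as `Theorems/SAWTowerCountCorridorMassFiveEighths<Stub>.lean
--supports stmt-CriticalPhenomena-7252` without importing this workfile.
-/

noncomputable section

namespace Summit.CriticalPhenomena.SAWScalingLimit.Cruxes.CorridorMassFiveEighths.Birth

open Summit.CriticalPhenomena.SAWScalingLimit.Theses.SAWTowerCount (LevelTwoSolitude CorridorCovariance PoissonKernelExpansion)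

/-! ### Vocabulary of the line: the two new statements, named -/

open scoped Classical in
/-- **U — uniform level-one gap of the `ℤ²` strip transfer spectrum coupled to bulk end insertions.**
`Z n ℓ i j` is the route's inlined `Z_n(ℓ;i,j)`.  There is `θ > 0` such that for every bulk margin `η > 0`,
all widths `n ≥ n₀(η)` and all bulk rows `i, j ∈ [ηn,(1−η)n]`: `Z_n(ℓ;i,j) = c μ^ℓ + O((μ e^{−θπ/n})^ℓ)` as
`ℓ → ∞`, for some `c, μ > 0` and an `O`-constant that may depend on `(n,i,j)` (only the RATE is uniform). -/
def UniformLevelOneGap : Prop :=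
  let Z : ℕ → ℕ → ℤ → ℤ → ℝ := fun n ℓ i j => ∑ s ∈ Finset.range ((ℓ + 1) * n + 1), Literature.Probability.RandomPlanarGeometry.SAW.criticalFugacity ^ s * ((((Literature.Probability.LatticeModels.zdGraph 2).finsetWalkLength s (![0, i] : Literature.Probability.LatticeModels.Site 2) ![(ℓ : ℤ), j]).filter (fun p => p.IsPath ∧ ∀ v ∈ p.support, 0 ≤ v 0 ∧ v 0 ≤ (ℓ : ℤ) ∧ 1 ≤ v 1 ∧ v 1 ≤ (n : ℤ))).card : ℝ); ∃ θ : ℝ, 0 < θ ∧ ∀ η : ℝ, 0 < η → ∃ n₀ : ℕ, ∀ n : ℕ, n₀ ≤ n → ∀ i j : ℤ, η * n ≤ i → i ≤ (1 - η) * n → η * n ≤ j → j ≤ (1 - η) * n → ∃ c μ C : ℝ, 0 < c ∧ 0 < μ ∧ ∃ L : ℕ, ∀ ℓ : ℕ, L ≤ ℓ → |Z n ℓ i j - c * μ ^ ℓ| ≤ C * (μ * Real.exp (-θ * Real.pi / n)) ^ ℓ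

open scoped Classical in
/-- **T⁺ — the gapped level-two solitude** (conclusion of the transfer stub G; VERBATIM the hypothesis `hLTS` of
`Theorems.SpectralPin.corridorMassFiveEighths_of_levelOneGap`, i.e. route item stmt-7253 `LevelTwoSolitude` plus
the one clause `k ≠ 0 → lam k ≤ lam 0 * Real.exp (-θ * Real.pi / n)` inside `∀ k ≤ K`, quantified
`∃ θ, 0 < θ ∧ θ ≤ 5/4 ∧ …`). -/
def GappedLevelTwoSolitude : Prop :=
  let Z : ℕ → ℕ → ℤ → ℤ → ℝ := fun n ℓ i j => ∑ s ∈ Finset.range ((ℓ + 1) * n + 1), Literature.Probability.RandomPlanarGeometry.SAW.criticalFugacity ^ s * ((((Literature.Probability.LatticeModels.zdGraph 2).finsetWalkLength s (![0, i] : Literature.Probability.LatticeModels.Site 2) ![(ℓ : ℤ), j]).filter (fun p => p.IsPath ∧ ∀ v ∈ p.support, 0 ≤ v 0 ∧ v 0 ≤ (ℓ : ℤ) ∧ 1 ≤ v 1 ∧ v 1 ≤ (n : ℤ))).card : ℝ); ∃ θ : ℝ, 0 < θ ∧ θ ≤ 5 / 4 ∧ ∀ η : ℝ, 0 < η → ∃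 (C₀ : ℝ) (Kmax n₀ : ℕ), ∀ n : ℕ, n₀ ≤ n → ∃ (K : ℕ) (lam e : ℕ → ℝ) (u : ℕ → ℤ → ℝ), K ≤ Kmax ∧ e 0 = 1 ∧ (∀ k ≤ K, 0 < lam k ∧ e k ^ 2 = 1 ∧ lam k ≤ lam 0 ∧ lam 0 * Real.exp (-(9 / 4) * Real.pi / n) < lam k ∧ (k ≠ 0 → lam k ≤ lam 0 * Real.exp (-θ * Real.pi / n))) ∧ (∀ k ≤ K, ∀ k' ≤ K, k ≠ k' → lam k ≠ lam k') ∧ (∃! k : ℕ, k ≤ K ∧ lam k < lam 0 * Real.exp (-(5 / 4) * Real.pi / n)) ∧ ∀ i j : ℤ, η * n ≤ i → i ≤ (1 - η) * n → η * n ≤ j → j ≤ (1 - η) * n → 0 < u 0 i ∧ (∀ k ≤ K, |u k i * u k j| ≤ C₀ * (u 0 i * u 0 j)) ∧ ∀ ℓ : ℕ, n ≤ ℓ → |Z n ℓ i j - ∑ k ∈ Finset.range (K + 1), e k * u k i * u k j * lam k ^ ℓ| ≤ C₀ * (u 0 i * u 0 j) * (lam 0 * Real.exp (-(9 / 4) *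 Real.pi / n)) ^ ℓ

/-! ### The stubs (the ONLY `sorry`s of this file) -/

/-- **T — the count (route item stmt-CriticalPhenomena-7253 `LevelTwoSolitude`, by name).** Real, positive,
distinct rates above the line `λ₀e^{−9π/4n}` with rank-one sign-free couplings and bounds relative to the
Perron term, EXACTLY ONE of them in the level-2 window — "one state at level two", the coefficients `1,1,1`
of `(1−q²)/∏(1−qⁿ)`.  Open-problem grade (transfer-matrix spectral statement for a non-symmetric,
non-integrable matrix, uniformly in the width). -/
theorem stub_levelTwoSolitude : LevelTwoSolitude := by
  sorry

open scoped Classical in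
/-- **U — uniform level-one gap** (the statement `UniformLevelOneGap`, written out): the first scaled gap of
the strip transfer spectrum coupled to bulk end insertions stays `≥ θ > 0` in units of `π/n` (conformal
prediction: it tends to `1`).  Open, of the same kind as T. -/
theorem stub_uniformLevelOneGap :
    let Z : ℕ → ℕ → ℤ → ℤ → ℝ := fun n ℓ i j => ∑ s ∈ Finset.range ((ℓ + 1) * n + 1), Literature.Probability.RandomPlanarGeometry.SAW.criticalFugacity ^ s * ((((Literature.Probability.LatticeModels.zdGraph 2).finsetWalkLength s (![0, i] : Literature.Probability.LatticeModels.Site 2) ![(ℓ : ℤ), j]).filter (fun p => p.IsPath ∧ ∀ v ∈ p.support, 0 ≤ v 0 ∧ v 0 ≤ (ℓ : ℤ) ∧ 1 ≤ v 1 ∧ v 1 ≤ (n : ℤ))).card : ℝ); ∃ θ : ℝ, 0 < θ ∧ ∀ η : ℝ, 0 < η → ∃ n₀ : ℕ, ∀ n : ℕ, n₀ ≤ n → ∀ i j : ℤ, η * n ≤ i → i ≤ (1 - η) * n → η * n ≤ j → j ≤ (1 - η) * n → ∃ c μ C : ℝ, 0 < c ∧ 0 < μ ∧ ∃ L : ℕ,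 ∀ ℓ : ℕ, L ≤ ℓ → |Z n ℓ i j - c * μ ^ ℓ| ≤ C * (μ * Real.exp (-θ * Real.pi / n)) ^ ℓ := by
  sorry

open scoped Classical in
/-- **G — gap upgrade (provable-now transfer, size M).** `LevelTwoSolitude → UniformLevelOneGap →
GappedLevelTwoSolitude`: by uniqueness of exponential asymptotics the named rates of T in the gap zone
`(λ₀e^{−θπ/n}, λ₀)` carry identically-zero couplings on bulk rows, so they can be dropped and the
representation re-indexed (`θ' = min θ (5/4)` keeps the unique window rate). -/
theorem stub_gapUpgrade :
    LevelTwoSolitude →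
    (let Z : ℕ → ℕ → ℤ → ℤ → ℝ := fun n ℓ i j => ∑ s ∈ Finset.range ((ℓ + 1) * n + 1), Literature.Probability.RandomPlanarGeometry.SAW.criticalFugacity ^ s * ((((Literature.Probability.LatticeModels.zdGraph 2).finsetWalkLength s (![0, i] : Literature.Probability.LatticeModels.Site 2) ![(ℓ : ℤ), j]).filter (fun p => p.IsPath ∧ ∀ v ∈ p.support, 0 ≤ v 0 ∧ v 0 ≤ (ℓ : ℤ) ∧ 1 ≤ v 1 ∧ v 1 ≤ (n : ℤ))).card : ℝ); ∃ θ : ℝ, 0 < θ ∧ ∀ η : ℝ, 0 < η → ∃ n₀ : ℕ, ∀ n : ℕ, n₀ ≤ n → ∀ i j : ℤ, η * n ≤ i → i ≤ (1 - η) * n → η * n ≤ j → j ≤ (1 - η) * n → ∃ c μ C : ℝ, 0 < c ∧ 0 < μ ∧ ∃ L : ℕ, ∀ ℓ : ℕ, L ≤ ℓ → |Z n ℓ i j - c * μ ^ ℓ| ≤ C * (μ * Real.exp (-θ * Real.pi / n)) ^ ℓ) →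
    (let Z : ℕ → ℕ → ℤ → ℤ → ℝ := fun n ℓ i j => ∑ s ∈ Finset.range ((ℓ + 1) * n + 1), Literature.Probability.RandomPlanarGeometry.SAW.criticalFugacity ^ s * ((((Literature.Probability.LatticeModels.zdGraph 2).finsetWalkLength s (![0, i] : Literature.Probability.LatticeModels.Site 2) ![(ℓ : ℤ), j]).filter (fun p => p.IsPath ∧ ∀ v ∈ p.support, 0 ≤ v 0 ∧ v 0 ≤ (ℓ : ℤ) ∧ 1 ≤ v 1 ∧ v 1 ≤ (n : ℤ))).card : ℝ); ∃ θ : ℝ, 0 < θ ∧ θ ≤ 5 / 4 ∧ ∀ η : ℝ, 0 < η → ∃ (C₀ : ℝ) (Kmax n₀ : ℕ), ∀ n : ℕ, n₀ ≤ n → ∃ (K : ℕ) (lam e : ℕ → ℝ) (u : ℕ → ℤ → ℝ), K ≤ Kmax ∧ e 0 = 1 ∧ (∀ k ≤ K, 0 < lam k ∧ e k ^ 2 = 1 ∧ lam k ≤ lam 0 ∧ lam 0 * Real.exp (-(9 / 4) * Real.pi / n) < lam k ∧ (k ≠ 0 → lam k ≤ lam 0 * Real.exp (-θ * Real.pi /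 n))) ∧ (∀ k ≤ K, ∀ k' ≤ K, k ≠ k' → lam k ≠ lam k') ∧ (∃! k : ℕ, k ≤ K ∧ lam k < lam 0 * Real.exp (-(5 / 4) * Real.pi / n)) ∧ ∀ i j : ℤ, η * n ≤ i → i ≤ (1 - η) * n → η * n ≤ j → j ≤ (1 - η) * n → 0 < u 0 i ∧ (∀ k ≤ K, |u k i * u k j| ≤ C₀ * (u 0 i * u 0 j)) ∧ ∀ ℓ : ℕ, n ≤ ℓ → |Z n ℓ i j - ∑ k ∈ Finset.range (K + 1), e k * u k i * u k j * lam k ^ ℓ| ≤ C₀ * (u 0 i * u 0 j) * (lam 0 * Real.exp (-(9 / 4) * Real.pi / n)) ^ ℓ) := by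
  sorry

/-- **C — corridor covariance with some exponent (route item stmt-CriticalPhenomena-7254 `CorridorCovariance`,
by name).** `∃ b > 0` and `A` regularly varying of index `2b` with `A(n)Z_n(⌊mn⌋;⌊yn⌋,⌊y′n⌋) → H_m(y,y′)^b`
locally uniformly — the Lawler–Schramm–Werner / Dyhr–Gilbert–Kennedy–Lawler–Passon conjecture in corridors,
exponent free.  Open-problem grade; implied by the crux (`b = 5/8`). -/
theorem stub_corridorCovariance : CorridorCovariance := by
  sorry

/-! ### Consistency: each named statement IS its registered stub (definitionally) -/

theorem uniformLevelOneGap_holds : UniformLevelOneGap := stub_uniformLevelOneGap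
theorem gapUpgrade_holds : LevelTwoSolitude → UniformLevelOneGap → GappedLevelTwoSolitude := stub_gapUpgrade

/-! ### Name-keyed aliases of the two written-out statements — hypotheses of `CorridorMassFiveEighths_of`

The skeleton audit admits a `Prop` hypothesis of the skeleton theorem only if its head constant is a registered
obligation (T and C are route items) or is NAMED like a declared stub; `__Registered.stub_X` is the statement of
`stub_X` under that name (the `__` namespace is an implementation detail, so the audit's stub report resolves
`stub_…` to the sorried theorems above, not to these aliases). -/
namespace __Registered

/-- Alias of `UniformLevelOneGap` keyed by the registered stub name. -/
abbrev stub_uniformLevelOneGap : Prop := UniformLevelOneGap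
/-- Alias of the transfer statement keyed by the registered stub name. -/
abbrev stub_gapUpgrade : Prop := LevelTwoSolitude → UniformLevelOneGap → GappedLevelTwoSolitude

end __Registered

/-! ### The skeleton theorem: the four stubs imply the crux, BY NAME -/

/-- **`CorridorMassFiveEighths` from the line `birth`** (kernel-checked, no `sorry` of its own): the transfer G
applied to the count T and the gap U yields `θ ∈ (0, 5/4]` and the gapped count; the LANDED repaired glue
`Theorems.SpectralPin.corridorMassFiveEighths_of_levelOneGap θ`, fed the LANDED `Theorems.poissonKernelExpansion_proof`
and the covariance C, is the crux.  Hypotheses = the four stubs (T, C by their route names; U, G under their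
registered names); conclusion = the route decl, by name. -/
theorem CorridorMassFiveEighths_of (hT : LevelTwoSolitude) (hU : __Registered.stub_uniformLevelOneGap)
    (hG : __Registered.stub_gapUpgrade) (hC : CorridorCovariance) :
    Summit.CriticalPhenomena.SAWScalingLimit.Theses.SAWTowerCount.CorridorMassFiveEighths := by
  obtain ⟨θ, hθ, hθ', hgap⟩ := hG hT hU
  exact Summit.CriticalPhenomena.SAWScalingLimit.Theorems.SpectralPin.corridorMassFiveEighths_of_levelOneGap
    θ hθ hθ' Summit.CriticalPhenomena.SAWScalingLimit.Theorems.poissonKernelExpansion_proof hgap hC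

/-- Wiring check (an `example`, so that `CorridorMassFiveEighths_of` stays the only theorem concluding the crux):
the four sorried stubs, with their tree-vocabulary types, feed the skeleton theorem as stated — this term becomes
the crux proof when the four `sorry`s above are discharged. -/
example : Summit.CriticalPhenomena.SAWScalingLimit.Theses.SAWTowerCount.CorridorMassFiveEighths :=
  CorridorMassFiveEighths_of stub_levelTwoSolitude stub_uniformLevelOneGap stub_gapUpgrade
    stub_corridorCovariance

end Summit.CriticalPhenomena.SAWScalingLimit.Cruxes.CorridorMassFiveEighths.Birth

end
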